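import Mathlib.RingTheory.LocalRing.ResidueField.Basic
import Summits.HodgeConjecture.HodgeConjecture.Theorems.R90S6HilbertNinetyGLn
import HarnessLib

/-!
# Integral Hilbert 90 for `GL_n`: `H¹(Γ, GL_n(R)) = 1` for a local ring `R` with a finite group of
# ring automorphisms whose inertia is trivial (e.g. `R = 𝒪_{L_w}`, `L_w/K_v` unramified)

R90-TF, section S6 (Rogawski Ch. 14.1–14.5, stable trace formula), card **W9-b** (DAG r5 row
E1.4.3.2.2 «INTEGRAL Hilbert 90, unramified: `H¹(Gal(L_w∕L⁺_v), GL_n(𝒪_{L_w})) = 1`», the descent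
step «fixed cosets descend» of Kottwitz's base-change fundamental lemma for units), helper lane for
`stmt-HodgeConjecture-24833`.

**Theorem** (`exists_isUnit_forall_mul_map_smul_eq_of_isLocalRing`). Let `R` be a commutative local
ring with maximal ideal `𝔪` and residue field `k`, and let a finite group `Γ` act on `R` by ring
automorphisms with TRIVIAL INERTIA: the only `s ∈ Γ` with `s(r) ≡ r (mod 𝔪)` for all `r` is `s = 1`
(equivalently `Γ` acts faithfully on `k`; for the valuation ring of a finite Galois extension of
local fields this says the extension is unramified — Mathlib's
`ValuationSubring.inertiaSubgroup` is the kernel of `Γ → Aut k`). Then every `1`-cocycle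
`c : Γ → GL_n(R)`, `c_{st} = c_s · s(c_t)` (entrywise action `s(M) = M.map (s • ·)`), is a
coboundary: `c_s · s(b) = b` for some `b ∈ GL_n(R)`.

No completeness, Noetherianity or valuation is used. Proof («unit averaging», Serre, *Local Fields*
X §1 Exercise 2; Kottwitz 1986 §3): reduce `c` modulo `𝔪` (Mathlib's residue-field action,
`IsLocalRing.ResidueField.residue_smul`); trivial inertia makes `Γ` act faithfully on the FIELD `k`,
so the field case `R90.S6.exists_isUnit_forall_mul_map_smul_eq` (`H¹(Γ, GL_n(k)) = 1`, valid in every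
characteristic — here `k` is typically finite) gives `ā ∈ GL_n(k)` with `c̄_s · s(ā) = ā`; Dedekind's
independence of characters (`linearIndependent_monoidHom`, through the tree's
`Literature.RingTheory.GaloisAlgebras.injective_toMonoidHom_toRingHom`) gives `e ∈ k` with
`u := Σ_s s(e) ≠ 0`; lifting `e • ā` to `x ∈ M_n(R)`, the Poincaré series `b := Σ_s c_s · s(x)`
satisfies `c_t · t(b) = Σ_s c_{ts} · (ts)(x) = b` and `b mod 𝔪 = Σ_s s(e) • c̄_s s(ā) = u • ā ∈ GL_n(k)`,
hence `b ∈ GL_n(R)` (a matrix over a local ring is invertible iff its reduction is).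

## References
* J.-P. Serre, *Local Fields*, GTM 67 (1979), Ch. X, §1, Prop. 3 and Exercise 2.
* R. E. Kottwitz, *Base change for unit elements of Hecke algebras*, Compositio Math. 60 (1986),
  237–250, §3 (the descent step).
-/

set_option autoImplicit false
set_option linter.dupNamespace false

namespace Summit.HodgeConjecture.HodgeConjecture.R90.S6

open Matrix

/-- **Integral Hilbert 90 for `GL_n` over a local ring with unramified group action
(`H¹(Γ, GL_n(R)) = 1`).** Let the finite group `Γ` act by ring automorphisms on the commutative
local ring `R` with trivial inertia (`hΓ`: if `s • r - r ∈ 𝔪` for all `r` then `s = 1`, i.e. `Γ`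
acts faithfully on the residue field — for `R = 𝒪_{L_w}` and `Γ = Gal(L_w/K_v)` this is
"`L_w/K_v` unramified"). Then every `1`-cocycle `c : Γ → M_n(R)` of invertible matrices for the
entrywise action, `c (s * t) = c s * s(c t)`, is a coboundary: `c s * s(b) = b` for an invertible
`b` (so `c s = b · s(b)⁻¹`). Proof by reduction to the residue field
(`R90.S6.exists_isUnit_forall_mul_map_smul_eq`, any characteristic), Dedekind's lemma and the
Poincaré series `b = Σ_s c_s · s(x)` («unit averaging»; Serre, *Local Fields* X §1 Ex. 2;
Kottwitz, Compositio 60 (1986) §3). -/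
theorem exists_isUnit_forall_mul_map_smul_eq_of_isLocalRing {Γ R n : Type*} [Group Γ] [Fintype Γ]
    [CommRing R] [IsLocalRing R] [MulSemiringAction Γ R] [Fintype n] [DecidableEq n]
    (hΓ : ∀ s : Γ, (∀ r : R, s • r - r ∈ IsLocalRing.maximalIdeal R) → s = 1)
    (c : Γ → Matrix n n R) (hcu : ∀ s, IsUnit (c s))
    (hc : ∀ s t, c (s * t) = c s * (c t).map (s • ·)) :
    ∃ a : Matrix n n R, IsUnit a ∧ ∀ s, c s * a.map (s • ·) = a := by
  classical
  -- Mathlib's induced action of `Γ` on the residue field commutes with the reduction map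
  have hπ : ∀ (s : Γ) (r : R),
      IsLocalRing.residue R (s • r) = s • IsLocalRing.residue R r := fun s r =>
    IsLocalRing.ResidueField.residue_smul Γ s r
  -- (0) elementary identities for the entrywise action on matrices over `R`
  have hmap_mul : ∀ (s : Γ) (M N : Matrix n n R),
      (M * N).map (s • ·) = M.map (s • ·) * N.map (s • ·) := by
    intro s M N
    ext i j
    simp only [Matrix.map_apply, Matrix.mul_apply, Finset.smul_sum, smul_mul']
  have hmap_smul : ∀ (s t : Γ) (M : Matrix n n R),
      (M.map (t • ·)).map (s • ·) = M.map ((s * t) • ·) := by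
    intro s t M
    rw [Matrix.map_map]
    exact congrArg M.map (funext fun a => (mul_smul s t a).symm)
  have hmap_π : ∀ (s : Γ) (M : Matrix n n R),
      (M.map (s • ·)).map (IsLocalRing.residue R) = (M.map (IsLocalRing.residue R)).map (s • ·) := by
    intro s M
    rw [Matrix.map_map, Matrix.map_map]
    exact congrArg M.map (funext fun a => hπ s a)
  -- (1) trivial inertia: `Γ` acts faithfully on the residue field
  haveI : FaithfulSMul Γ (IsLocalRing.ResidueField R) := ⟨fun {s t} hst => by
    have h1 : t⁻¹ * s = 1 := by
      refine hΓ (t⁻¹ * s) fun r => ?_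
      rw [← IsLocalRing.residue_eq_zero_iff, map_sub, sub_eq_zero, hπ, mul_smul, hst,
        inv_smul_smul]
    exact (eq_of_inv_mul_eq_one h1).symm⟩
  -- (2) the reduced cocycle and the field case: `ā ∈ GL_n(k)` with `c̄_s · s(ā) = ā`
  have hcuπ : ∀ s, IsUnit ((c s).map (IsLocalRing.residue R)) := fun s =>
    (hcu s).map (IsLocalRing.residue R).mapMatrix
  have hcπ : ∀ s t, (c (s * t)).map (IsLocalRing.residue R) =
      (c s).map (IsLocalRing.residue R) * ((c t).map (IsLocalRing.residue R)).map (s • ·) := by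
    intro s t
    rw [hc, Matrix.map_mul, hmap_π]
  obtain ⟨ā, hā, hāfix⟩ :=
    exists_isUnit_forall_mul_map_smul_eq (fun s => (c s).map (IsLocalRing.residue R)) hcuπ hcπ
  have hfix : ∀ s : Γ, (c s).map (IsLocalRing.residue R) * ā.map (s • ·) = ā := hāfix
  -- (3) Dedekind: some `e ∈ k` has `Σ_s s(e) ≠ 0`
  obtain ⟨e, he⟩ : ∃ e : IsLocalRing.ResidueField R, ∑ s : Γ, s • e ≠ 0 := by
    by_contra! hall
    have hind := (linearIndependent_monoidHom (IsLocalRing.ResidueField R)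
      (IsLocalRing.ResidueField R)).comp _
      (Literature.RingTheory.GaloisAlgebras.injective_toMonoidHom_toRingHom Γ
        (IsLocalRing.ResidueField R))
    have h10 := Fintype.linearIndependent_iff.mp hind (fun _ => 1) (by
      ext y
      simp only [Function.comp_apply, Finset.sum_apply, one_smul, Pi.zero_apply,
        MonoidHom.coe_coe, MulSemiringAction.toRingHom_apply]
      exact hall y) 1
    exact one_ne_zero h10
  -- (4) lift `e • ā` to `x ∈ M_n(R)` and form the Poincaré series `b = Σ_s c_s · s(x)`
  obtain ⟨x, hx⟩ : ∃ x : Matrix n n R, x.map (IsLocalRing.residue R) = e • ā := by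
    refine ⟨(e • ā).map (Function.surjInv (IsLocalRing.residue_surjective (R := R))), ?_⟩
    ext i j
    simp only [Matrix.map_apply, Function.surjInv_eq IsLocalRing.residue_surjective]
  obtain ⟨b, hbdef⟩ : ∃ b : Matrix n n R, b = ∑ s, c s * x.map (s • ·) := ⟨_, rfl⟩
  -- (5) `b mod 𝔪 = (Σ_s s(e)) • ā` is invertible, hence so is `b`
  have hbπ : b.map (IsLocalRing.residue R) = (∑ s : Γ, s • e) • ā := by
    have h1 : b.map (IsLocalRing.residue R) =
        ∑ s, (c s).map (IsLocalRing.residue R) * (e • ā).map (s • ·) := by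
      rw [hbdef, ← RingHom.mapMatrix_apply, map_sum]
      refine Finset.sum_congr rfl fun s _ => ?_
      rw [map_mul, RingHom.mapMatrix_apply, RingHom.mapMatrix_apply, hmap_π, hx]
    rw [h1, Finset.sum_smul]
    refine Finset.sum_congr rfl fun s _ => ?_
    rw [Matrix.map_smulₛₗ (s • ·) (s • ·) e (fun a => smul_mul' s e a) ā, Matrix.mul_smul, hfix s]
  have hb : IsUnit b := by
    rw [Matrix.isUnit_iff_isUnit_det, ← isUnit_map_iff (IsLocalRing.residue R), RingHom.map_det,
      RingHom.mapMatrix_apply, hbπ, Matrix.det_smul]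
    exact ((isUnit_iff_ne_zero.mpr he).pow _).mul ((Matrix.isUnit_iff_isUnit_det _).mp hā)
  -- (6) the cocycle identity makes `b` work: `c_t · t(b) = Σ_s c_{ts} · (ts)(x) = b`
  refine ⟨b, hb, fun t => ?_⟩
  have hmap_sum : ∀ F : Γ → Matrix n n R, (∑ s, F s).map (t • ·) = ∑ s, (F s).map (t • ·) := by
    intro F
    ext i j
    simp only [Matrix.map_apply, Matrix.sum_apply, Finset.smul_sum]
  rw [hbdef, hmap_sum, Finset.mul_sum]
  calc ∑ s, c t * (c s * x.map (s • ·)).map (t • ·)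
      = ∑ s, c (t * s) * x.map ((t * s) • ·) :=
        Finset.sum_congr rfl fun s _ => by rw [hmap_mul, hmap_smul, ← Matrix.mul_assoc, ← hc]
    _ = ∑ s, c s * x.map (s • ·) :=
        Fintype.sum_equiv (Equiv.mulLeft t) _ _ fun _ => rfl

end Summit.HodgeConjecture.HodgeConjecture.R90.S6
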